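import Summits.CriticalPhenomena.SAWScalingLimit.Theorems.SAWDefectDecoherenceBoundaryClosureRInnerZigzagCarrier
import Summits.CriticalPhenomena.SAWScalingLimit.Theorems.SAWDefectDecoherenceBoundaryClosureRInnerZigzagSides
import Summits.CriticalPhenomena.SAWScalingLimit.Theorems.SAWDefectDecoherenceBoundaryClosureRInnerPolygonsMarks
import Summits.CriticalPhenomena.SAWScalingLimit.Theorems.SAWDefectDecoherenceBoundaryClosureRInnerPolygonsComplement
import HarnessLib

/-!
# Crux `BoundaryClosureR` (stmt-CriticalPhenomena-14004), line `polygon-parity-squeeze`: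
# the registered stub `stub_innerZigzagPolygon` (7a) — the inner exact zigzag polygon of a doubly
# pinned Dobrushin datum (continuum half of the inner-polygon construction (IP))

Landing target:
`Summits/CriticalPhenomena/SAWScalingLimit/Theorems/SAWDefectDecoherenceBoundaryClosureRInnerZigzagPolygon.lean`
(`--supports stmt-CriticalPhenomena-14004`).

**Statement** (`stub_innerZigzagPolygon`, registered verbatim).  For a Dobrushin domain `(Ω; pt 0, pt 1)`
which is the open upper half-ball inside `B(pt 1, ρ)` and inside `B(pt 0, r₁)`, `ρ + r₁ ≤ |pt 0 - pt 1|`,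
and `η > 0`, there are a Dobrushin domain `P` with the same marked points, a finite corner set and
`r > 0` such that: `P ⊆ Ω`; the `η`-deep part of `Ω` lies in `P`; `P` is the FULL upper half-ball inside
`B(pt 1, 7ρ/8)` and `B(pt 0, 7r₁/8)`; `∂P` off `B(pt 1, 15ρ/16) ∪ B(pt 0, 15r₁/16)` lies in `Ω`;
`r ≤ ρ/16, r₁/16`; the corners are on `∂P`, at distance `≥ r` from both pins; every boundary point at
distance `≥ r` from the corners is a zigzag FLAT SIDE point of radius `r/2`; every corner is a zigzag
CORNER of radius `2r` (intersection or union of two zigzag half-planes).  This is exactly what the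
lattice half (7b, `stub_innerPolygonsOfZigzag`) consumes to produce the inner exact polygon family of
the squeeze (B) of the line.

**Construction and proof** (files `…InnerZigzag{Cells,Levels,Edges,Grid,Inside,Local,Setup,Assembly,Carrier}`):
a connected compact `K' ⊆ Ω` through the `η`-deep part and the two points `pt 1 + iρ/2`,
`pt 0 + i r₁/2` (`exists_isCompact_isConnected_superset`), of depth `d' > 0`; a mesh
`h ≤ min(ρ, r₁, d')/4000` making both pin lines grid lines (`exists_mesh`); the face set
`K = tileFaces S ∪ R₁ ∪ R₀` (tiles with `5h`-deep centres, two grid trapezoids of `20` rows on the pins),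
pinch-free (`K_noPinch`); the left-hand boundary walk from the gate dart, a simple closed zigzag polygon
(`boundaryPolygon_isSimpleClosed`), its `polygonDomain` `P` (inside by the tree's Jordan curve
theorem); `P ⊆ Ω` (`carrier_subset_domain`), the pinned half-balls, the anchor face and `K'` inside
(`…Carrier`); all `K`-faces along the cycle inside, all others outside (`…Inside`); local structure
(`…Local`); corners := cycle vertices off the two pin balls of radius `3h`; transport by the similarity
`w ↦ pt 1 + h·w` (`JordanDomain.map`) and marking (`exists_dobrushinDomain_of_frontier_points`).

Sources: H. Duminil-Copin, S. Smirnov, Ann. of Math. 175 (2012) §3 (domains approximated by lattice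
domains); folklore.  No definition and no named fact is introduced.
-/

noncomputable section

open scoped ComplexConjugate Topology
open Set Metric Filter
open Literature.Probability.LatticeModels
open Literature.Probability.Percolation (triX triY triCell triCellStrict triX_triEmbed triY_triEmbed triDir)
open Literature.Probability.RandomPlanarGeometry
open Summit.CriticalPhenomena.SAWScalingLimit.Theorems.PolygonParitySqueeze.BoundaryWalk
open Summit.CriticalPhenomena.SAWScalingLimit.Theorems.PolygonParitySqueeze.InnerZigzag

namespace Summit.CriticalPhenomena.SAWScalingLimit.Theorems.PolygonParitySqueeze

/-- **The normalised pins.**  From the real data at the two pins and a mesh `h` with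
`Im (pt 0 - pt 1) = N·h·√3/2`: the normalised root pin `p0n` (on row `N`, within `1/2` of the base
lattice point `X₀` along the row), the base half-widths `a = ⌊0.9ρ/h⌋`, `a₀ = ⌊0.9r₁/h⌋`, and the
flatness / depth statements in the normalised coordinate. [folklore] -/
theorem normalised_pins (D : DobrushinDomain) {ρ r₁ h : ℝ} (hh : 0 < h) (hρh : 4000 * h ≤ ρ) (hr₁h : 4000 * h ≤ r₁)
    {N : ℤ} (hN : (D.pt 0).im - (D.pt 1).im = N * (h * (Real.sqrt 3 / 2)))
    (hflat1r : D.carrier ∩ ball (D.pt 1) ρ = {z : ℂ | (D.pt 1).im < z.im} ∩ ball (D.pt 1) ρ)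
    (hflat0r : D.carrier ∩ ball (D.pt 0) r₁ = {z : ℂ | (D.pt 0).im < z.im} ∩ ball (D.pt 0) r₁)
    (hdistr : ρ + r₁ ≤ dist (D.pt 0) (D.pt 1)) :
    ∃ (p0n : ℂ) (X₀ a a₀ : ℤ), D.pt 1 + h * p0n = D.pt 0 ∧ (triY p0n = N ∧ |triX p0n - X₀| ≤ 1 / 2) ∧
      ρ / h + r₁ / h ≤ ‖p0n‖ ∧ ((a : ℝ) ≤ 9 / 10 * (ρ / h) ∧ 9 / 10 * (ρ / h) - 1 < a) ∧
      ((a₀ : ℝ) ≤ 9 / 10 * (r₁ / h) ∧ 9 / 10 * (r₁ / h) - 1 < a₀) ∧ 0 ≤ a ∧ 0 ≤ a₀ ∧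
      (∀ w : ℂ, ‖w‖ < ρ / h → (D.pt 1 + h * w ∈ D.carrier ↔ 0 < w.im)) ∧
      (∀ w : ℂ, ‖w‖ < ρ / h → min (h * w.im) (ρ - h * ‖w‖) ≤ infDist (D.pt 1 + h * w) D.carrierᶜ) ∧
      (∀ w : ℂ, ‖w - p0n‖ < r₁ / h → (D.pt 1 + h * w ∈ D.carrier ↔ p0n.im < w.im)) ∧
      (∀ w : ℂ, ‖w - p0n‖ < r₁ / h → min (h * (w - p0n).im) (r₁ - h * ‖w - p0n‖) ≤ infDist (D.pt 1 + h * w) D.carrierᶜ) ∧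
      h * a ≤ 9 / 10 * ρ ∧ h * a₀ ≤ 9 / 10 * r₁ := by
  have hΩc : D.carrierᶜ.Nonempty := Set.nonempty_compl.2 D.carrier_ne_univ
  have hhc : (h : ℂ) ≠ 0 := Complex.ofReal_ne_zero.2 hh.ne'
  set o : ℂ := D.pt 1 with ho
  set p0n : ℂ := (h : ℂ)⁻¹ * (D.pt 0 - o) with hp0n_def
  have hp0 : o + h * p0n = D.pt 0 := sim_surj o hh.ne' _
  have hp0n_im : p0n.im = N * (Real.sqrt 3 / 2) := by
    have e : (h : ℂ) * p0n = D.pt 0 - o := by rw [hp0n_def, ← mul_assoc, mul_inv_cancel₀ hhc, one_mul]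
    have := congrArg Complex.im e
    simp only [Complex.mul_im, Complex.ofReal_re, Complex.ofReal_im, zero_mul, add_zero, Complex.sub_im] at this
    rw [hN] at this
    have : h * p0n.im = h * (N * (Real.sqrt 3 / 2)) := by linarith
    exact mul_left_cancel₀ hh.ne' this
  have hY : triY p0n = N := by
    have h3 : Real.sqrt 3 ≠ 0 := by positivity
    show p0n.im * 2 / Real.sqrt 3 = N
    rw [hp0n_im]; field_simp
  set a : ℤ := ⌊9 / 10 * (ρ / h)⌋ with ha_def
  set a₀ : ℤ := ⌊9 / 10 * (r₁ / h)⌋ with ha₀_def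
  have ha : (a : ℝ) ≤ 9 / 10 * (ρ / h) ∧ 9 / 10 * (ρ / h) - 1 < a := ⟨Int.floor_le _, Int.sub_one_lt_floor _⟩
  have ha₀ : (a₀ : ℝ) ≤ 9 / 10 * (r₁ / h) ∧ 9 / 10 * (r₁ / h) - 1 < a₀ := ⟨Int.floor_le _, Int.sub_one_lt_floor _⟩
  have hρn : 4000 ≤ ρ / h := by rw [le_div_iff₀ hh]; linarith
  have hrn : 4000 ≤ r₁ / h := by rw [le_div_iff₀ hh]; linarith
  have ha0 : 0 ≤ a := by
    have : (0 : ℝ) ≤ a := by linarith [ha.2]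
    exact_mod_cast this
  have ha₀0 : 0 ≤ a₀ := by
    have : (0 : ℝ) ≤ a₀ := by linarith [ha₀.2]
    exact_mod_cast this
  have hha : h * a ≤ 9 / 10 * ρ := by
    have := mul_le_mul_of_nonneg_left ha.1 hh.le
    rwa [show h * (9 / 10 * (ρ / h)) = 9 / 10 * ρ by field_simp] at this
  have hha₀ : h * a₀ ≤ 9 / 10 * r₁ := by
    have := mul_le_mul_of_nonneg_left ha₀.1 hh.le
    rwa [show h * (9 / 10 * (r₁ / h)) = 9 / 10 * r₁ by field_simp] at this
  have hdist : ρ / h + r₁ / h ≤ ‖p0n‖ := by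
    have e : dist (D.pt 0) (D.pt 1) = h * ‖p0n‖ := by
      rw [← hp0, show D.pt 1 = o + h * 0 by rw [mul_zero, add_zero], dist_sim o hh.le, dist_zero_right]
    rw [e] at hdistr
    rw [← add_div, div_le_iff₀ hh]; linarith
  refine ⟨p0n, round (triX p0n), a, a₀, hp0, ⟨hY, abs_sub_round _⟩, hdist, ha, ha₀, ha0, ha₀0, fun w hw => ?_, fun w hw => ?_,
    fun w hw => (flat_normalised hh hp0 hflat0r hΩc w hw).1, fun w hw => (flat_normalised hh hp0 hflat0r hΩc w hw).2, hha, hha₀⟩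
  · have := (flat_normalised (c := 0) hh (by rw [mul_zero, add_zero]) hflat1r hΩc w (by rwa [sub_zero])).1
    rwa [Complex.zero_im] at this
  · have := (flat_normalised (c := 0) hh (by rw [mul_zero, add_zero]) hflat1r hΩc w (by rwa [sub_zero])).2
    rwa [sub_zero] at this

/-- **The normalised window complement**: the complement of `Ω` minus the two open windows under the
pins, read in the normalised coordinate, is connected and unbounded. [folklore] -/
theorem exists_windowsComplement (D : DobrushinDomain) {ρ r₁ h : ℝ} (hh : 0 < h) (hρh : 4000 * h ≤ ρ)
    (hr₁h : 4000 * h ≤ r₁) {p0n : ℂ} {a a₀ : ℤ} (hp0 : D.pt 1 + h * p0n = D.pt 0) (ha0 : 0 ≤ a) (ha₀0 : 0 ≤ a₀)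
    (hha : h * a ≤ 9 / 10 * ρ) (hha₀ : h * a₀ ≤ 9 / 10 * r₁)
    (hflat1r : D.carrier ∩ ball (D.pt 1) ρ = {z : ℂ | (D.pt 1).im < z.im} ∩ ball (D.pt 1) ρ)
    (hflat0r : D.carrier ∩ ball (D.pt 0) r₁ = {z : ℂ | (D.pt 0).im < z.im} ∩ ball (D.pt 0) r₁)
    (hdistr : ρ + r₁ ≤ dist (D.pt 0) (D.pt 1)) :
    ∃ X₁ : Set ℂ, IsConnected X₁ ∧ ¬ Bornology.IsBounded X₁ ∧ ∀ w : ℂ, w ∈ X₁ ↔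
      (D.pt 1 + h * w ∉ D.carrier ∧ ¬ (|w.re| < a + 25 ∧ |w.im| < 1) ∧ ¬ (|(w - p0n).re| < a₀ + 25 ∧ |(w - p0n).im| < 1)) := by
  have ha0' : (0 : ℝ) ≤ a := by exact_mod_cast ha0
  have ha₀0' : (0 : ℝ) ≤ a₀ := by exact_mod_cast ha₀0
  obtain ⟨hXc, hXb⟩ := isConnected_compl_carrier_diff_two_windows D (D.pt 1) (D.pt 0) ρ r₁ (h * (a + 25)) h (h * (a₀ + 25)) h
    (by positivity) hh (by linarith) (by positivity) hh (by linarith) (by rw [dist_comm]; exact hdistr) hflat1r hflat0r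
  set φ := simHomeomorph (D.pt 1) h hh.ne' with hφ
  have hφ_apply : ∀ w, φ w = D.pt 1 + h * w := fun w => rfl
  set Xr := (D.carrierᶜ \ {z : ℂ | |(z - D.pt 1).re| < h * (a + 25) ∧ |(z - D.pt 1).im| < h}) \
    {z : ℂ | |(z - D.pt 0).re| < h * (a₀ + 25) ∧ |(z - D.pt 0).im| < h} with hXr
  refine ⟨φ ⁻¹' Xr, φ.isConnected_preimage.2 hXc, fun hb => hXb ?_, fun w => ?_⟩
  · have : Xr = φ '' (φ ⁻¹' Xr) := (Set.image_preimage_eq _ φ.surjective).symm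
    rw [this]
    exact (hb.isCompact_closure.image φ.continuous).isBounded.subset (image_mono subset_closure)
  · have e1 : D.pt 1 + ↑h * w - D.pt 1 = h * w := add_sub_cancel_left _ _
    have e0 : D.pt 1 + ↑h * w - D.pt 0 = h * (w - p0n) := by rw [← hp0]; ring
    have hre : ∀ u : ℂ, ((h : ℂ) * u).re = h * u.re := fun u => by simp
    have him : ∀ u : ℂ, ((h : ℂ) * u).im = h * u.im := fun u => by simp
    have r : ∀ (u : ℂ) (A : ℝ), |((h : ℂ) * u).re| < h * A ↔ |u.re| < A := fun u A => by
      rw [hre, abs_mul, abs_of_pos hh]; constructor <;> intro hlt <;> nlinarith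
    have i : ∀ u : ℂ, |((h : ℂ) * u).im| < h ↔ |u.im| < 1 := fun u => by
      rw [him, abs_mul, abs_of_pos hh]; constructor <;> intro hlt <;> nlinarith
    simp only [mem_preimage, hφ_apply, hXr, Set.mem_sdiff, mem_compl_iff, mem_setOf_eq, e1, e0, r, i, and_assoc]

/-- **The inner exact zigzag polygon of a doubly pinned Dobrushin datum** (registered stub
`stub_innerZigzagPolygon`, 7a, continuum half of the inner-polygon construction (IP) of the squeeze):
see the module docstring. [cite: DuminilCopinSmirnov2012, §3 (discrete domains approximating a domain)] -/
theorem stub_innerZigzagPolygon : ∀ (D : DobrushinDomain) (ρ r₁ η : ℝ), 0 < ρ → 0 < r₁ → 0 < η → D.carrier ∩ Metric.ball (D.pt 1) ρ = {z : ℂ | (D.pt 1).im < z.im} ∩ Metric.ball (D.pt 1) ρ → D.carrier ∩ Metric.ball (D.pt 0) r₁ = {z : ℂ | (D.pt 0).im < z.im} ∩ Metric.ball (D.pt 0) r₁ → ρ + r₁ ≤ dist (D.pt 0) (D.pt 1) → ∃ (P : DobrushinDomain) (corners : Finset ℂ) (r : ℝ), P.pt 0 = D.pt 0 ∧ P.pt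 1 = D.pt 1 ∧ P.carrier ⊆ D.carrier ∧ {z : ℂ | z ∈ D.carrier ∧ η ≤ Metric.infDist z D.carrierᶜ} ⊆ P.carrier ∧ P.carrier ∩ Metric.ball (D.pt 1) (7 * ρ / 8) = {z : ℂ | (D.pt 1).im < z.im} ∩ Metric.ball (D.pt 1) (7 * ρ / 8) ∧ P.carrier ∩ Metric.ball (D.pt 0) (7 * r₁ / 8) = {z : ℂ | (D.pt 0).im < z.im} ∩ Metric.ball (D.pt 0) (7 * r₁ / 8) ∧ frontier P.carrier \ (Metric.ball (D.pt 1) (15 * ρ / 16) ∪ Metric.ball (D.pt 0) (15 * r₁ / 16)) ⊆ D.carrier ∧ 0 < r ∧ r ≤ ρ / 16 ∧ r ≤ r₁ / 16 ∧ (↑corners : Set ℂ) ⊆ frontier P.carrier ∧ (∀ i : Fin 2, ∀ c ∈ corners, r ≤ dist (P.pt i) c) ∧ (∀ z ∈ frontier P.carrier, (∀ c ∈ corners, r ≤ dist z c) → ∃ k : Fin 6, P.carrier ∩ Metric.ball z (r / 2) = halfPlane k z ∩ Metric.ball z (r / 2)) ∧ (∀ z ∈ corners, ∃ k k' : Fin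 6, P.carrier ∩ Metric.ball z (2 * r) = halfPlane k z ∩ halfPlane k' z ∩ Metric.ball z (2 * r) ∨ P.carrier ∩ Metric.ball z (2 * r) = (halfPlane k z ∪ halfPlane k' z) ∩ Metric.ball z (2 * r)) := by
  intro D ρ r₁ η hρ hr₁ hη hflat1r hflat0r hdistr
  -- ### the datum
  have ho_fr : D.pt 1 ∈ frontier D.carrier := D.pt_mem_frontier 1
  have hp_fr : D.pt 0 ∈ frontier D.carrier := D.pt_mem_frontier 0
  have hnotin : ∀ z ∈ frontier D.carrier, z ∉ D.carrier := fun z hz hzin => by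
    have : z ∈ D.carrier ∩ frontier D.carrier := ⟨hzin, hz⟩
    rw [D.isOpen.inter_frontier_eq] at this; exact this
  have hq : ∀ (x : ℂ) (R : ℝ), 0 < R → D.carrier ∩ ball x R = {z : ℂ | x.im < z.im} ∩ ball x R →
      x + Complex.I * ((R / 2 : ℝ) : ℂ) ∈ D.carrier := by
    intro x R hR hflat
    have : x + Complex.I * ((R / 2 : ℝ) : ℂ) ∈ {z : ℂ | x.im < z.im} ∩ ball x R := by
      constructor
      · simp; linarith
      · rw [mem_ball, dist_eq_norm, add_sub_cancel_left, norm_mul, Complex.norm_I, one_mul, Complex.norm_real,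
          Real.norm_of_nonneg (by linarith)]; linarith
    rw [← hflat] at this; exact this.1
  obtain ⟨K', d', -, hK'conn, -, hd', hK'deep, hq1K, hq0K, hdeepK⟩ :=
    exists_deep_core D hη (hq _ _ hρ hflat1r) (hq _ _ hr₁ hflat0r)
  -- ### the mesh and the normalised pins
  obtain ⟨h, hh, hhε, N, hN⟩ := exists_mesh ((D.pt 0).im - (D.pt 1).im) (min (min ρ r₁) d' / 4000) (by positivity)
  have hε1 : min (min ρ r₁) d' ≤ ρ := (min_le_left _ _).trans (min_le_left _ _)
  have hε2 : min (min ρ r₁) d' ≤ r₁ := (min_le_left _ _).trans (min_le_right _ _)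
  have hε3 : min (min ρ r₁) d' ≤ d' := min_le_right _ _
  have hρh : 4000 * h ≤ ρ := by linarith
  have hr₁h : 4000 * h ≤ r₁ := by linarith
  have hρn : 4000 ≤ ρ / h := by rw [le_div_iff₀ hh]; linarith
  have hrn : 4000 ≤ r₁ / h := by rw [le_div_iff₀ hh]; linarith
  obtain ⟨p0n, X₀, a, a₀, hp0, hp0nYX, hdist, ha, ha₀, ha0, ha₀0, hflat1, hdepth1, hflat0, hdepth0, hha, hha₀⟩ :=
    normalised_pins D hh hρh hr₁h hN hflat1r hflat0r hdistr
  set o : ℂ := D.pt 1 with ho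
  -- ### the face set
  obtain ⟨S, hS⟩ := exists_deepTiles D.carrier D.isBounded o hh (η₁ := 5 * h) (by positivity)
  obtain ⟨R₁, hR₁⟩ := exists_trapezoid a a 20 0 0 ha0 ha0 (by norm_num)
  obtain ⟨R₀, hR₀⟩ := exists_trapezoid a₀ a₀ 20 X₀ N ha₀0 ha₀0 (by norm_num)
  have hK := K_noPinch hh hρh hr₁h hflat1 hflat0 hp0nYX hdist ha ha₀ hS hR₁ hR₀ hdepth1 hdepth0
  have h₀ := d0_mem_bdDarts hh hρh hr₁h hflat1 hp0nYX hdist ha ha₀ hS hR₁ hR₀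
  set K := tileFaces S ∪ R₁ ∪ R₀ with hKdef
  -- ### the boundary cycle and its inside
  obtain ⟨Per, hP0, hPd, hmin⟩ := exists_minimal_period h₀
  have hsimp := isSimpleClosedPolygon_bverts hK h₀ hP0 hPd hmin 0 one_pos
  set PD := polygonDomain (bverts K 0 1 ((0 : Site 2), (0 : Fin 6)) Per) hsimp with hPD
  obtain ⟨V, hVo, -, hPV, hunion, hfV, -⟩ :=
    PD.exists_outside Literature.Topology.PlaneTopology.JordanCurveTheorem_holds
  have hV : IsOpen V ∧ Disjoint PD.carrier V ∧ PD.carrier ∪ V = (frontier PD.carrier)ᶜ ∧ frontier V = frontier PD.carrier :=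
    ⟨hVo, hPV, hunion, hfV⟩
  obtain ⟨X₁, hX₁⟩ := exists_windowsComplement D hh hρh hr₁h hp0 ha0 ha₀0 hha hha₀ hflat1r hflat0r hdistr
  set φ := simHomeomorph o h hh.ne' with hφ
  have hφ_apply : ∀ w, φ w = o + h * w := fun w => rfl
  have hhc : (h : ℂ) ≠ 0 := Complex.ofReal_ne_zero.2 hh.ne'
  -- ### inside facts
  have hsub := carrier_subset_domain hh hρh hr₁h hflat1 hflat0 hp0nYX hdist ha ha₀ hS hR₁ hR₀ hX₁ hsimp hPd hV
  have hup := upper_one_subset_carrier hh hρh hr₁h hflat1 hflat0 hp0nYX hdist ha ha₀ hS hR₁ hR₀ hdepth1 hX₁ hsimp hPd hV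
  have hbase := anchor_inside hh hρh hr₁h hflat1 hflat0 hp0nYX hdist ha ha₀ hS hR₁ hR₀ hdepth1 hX₁ hsimp hPd hV
  have hdeep := deep_connected_subset_carrier hh hρh hr₁h hflat1 hflat0 hp0nYX hdist ha ha₀ hS hR₁ hR₀ hdepth1 hdepth0
    hX₁ hsimp hPd hV (C := φ ⁻¹' K') (φ.isConnected_preimage.2 hK'conn)
    (fun w hw => by have := hK'deep _ hw; rw [hφ_apply] at this; linarith)
    (by rw [mem_preimage, hφ_apply]; convert hq1K using 1; push_cast; field_simp)
    (by rw [mem_preimage, hφ_apply]; convert hq0K using 1; rw [← hp0]; push_cast; field_simp; ring)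
  -- ### local structure inputs
  have hin := fan_inside hsimp h₀ hPd hV hK hbase
  have hout := fan_outside hsimp h₀ hPd hV hK hbase hP0
  have hΓ := fun z (hz : z ∈ frontier PD.carrier) => exists_cells_of_mem_frontier hsimp h₀ hPd hz
  have hleft := leftFace_inside hsimp h₀ hPd hV hK hbase
  have hright := rightFace_outside hsimp h₀ hPd hV hK hbase hP0
  have hsegΓ : ∀ t : ℕ, segment ℝ (triEmbed (bwalk K (0, 0) t).1) (triEmbed ((bwalk K (0, 0) t).1 + triDir (bwalk K (0, 0) t).2)) ⊆
      frontier PD.carrier := by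
    intro t w hw
    refine (mem_frontier_iff hsimp h₀ hPd).2 ⟨t % Per, Nat.mod_lt t hP0, ?_⟩
    rw [bwalk_mod_period hPd]; exact hw
  have hcyc : ∀ u ∈ frontier PD.carrier, o + h * u ∈ D.carrier ∨ (u.im = 0 ∧ ‖u‖ ≤ a + 24) ∨
      (u.im = p0n.im ∧ ‖u - p0n‖ ≤ a₀ + 49 / 2) := by
    intro u hu
    obtain ⟨t, -, hzL, -, hL, -⟩ := hΓ u hu
    exact K_cell_cases hh hρh hr₁h hflat1 hflat0 hp0nYX ha ha₀ hS hR₁ hR₀ hL hzL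
  -- the two pinned half-balls, normalised
  have hpin1 : PD.carrier ∩ ball (0 : ℂ) (7 / 8 * (ρ / h)) = {w : ℂ | (0 : ℂ).im < w.im} ∩ ball (0 : ℂ) (7 / 8 * (ρ / h)) := by
    apply Subset.antisymm
    · rintro w ⟨hwP, hwB⟩
      refine ⟨?_, hwB⟩
      rw [mem_ball, dist_zero_right] at hwB
      rw [Complex.zero_im]
      exact (hflat1 w (by linarith)).1 (hsub hwP)
    · rintro w ⟨hwi, hwB⟩
      rw [Complex.zero_im] at hwi
      exact ⟨hup ⟨hwi, hwB⟩, hwB⟩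
  have hpin0 : PD.carrier ∩ ball p0n (7 / 8 * (r₁ / h)) = {w : ℂ | p0n.im < w.im} ∩ ball p0n (7 / 8 * (r₁ / h)) := by
    apply Subset.antisymm
    · rintro w ⟨hwP, hwB⟩
      refine ⟨?_, hwB⟩
      rw [mem_ball, dist_eq_norm] at hwB
      exact (hflat0 w (by linarith)).1 (hsub hwP)
    · rintro w ⟨hwi, hwB⟩
      exact ⟨hdeep.2 ⟨hwi, hwB⟩, hwB⟩
  -- the pins are on the cycle
  have hfr_of : ∀ c : ℂ, o + h * c ∉ D.carrier → {w : ℂ | c.im < w.im} ∩ ball c 1 ⊆ PD.carrier → c ∈ frontier PD.carrier := by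
    intro c hc hballs
    rw [frontier_eq_closure_inter_closure]
    refine ⟨Metric.mem_closure_iff.2 fun ε hε => ?_, subset_closure fun hcP => hc (hsub hcP)⟩
    refine ⟨c + Complex.I * ((min ε 1 / 2 : ℝ) : ℂ), hballs ⟨?_, ?_⟩, ?_⟩
    · simp; positivity
    · rw [mem_ball, dist_eq_norm, add_sub_cancel_left, norm_mul, Complex.norm_I, one_mul, Complex.norm_real,
        Real.norm_of_nonneg (by positivity)]
      have : min ε 1 ≤ 1 := min_le_right _ _
      linarith
    · rw [dist_comm, dist_eq_norm, add_sub_cancel_left, norm_mul, Complex.norm_I, one_mul, Complex.norm_real,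
        Real.norm_of_nonneg (by positivity)]
      have : min ε 1 ≤ ε := min_le_left _ _
      linarith
  have h0fr : (0 : ℂ) ∈ frontier PD.carrier := by
    refine hfr_of 0 (by rw [mul_zero, add_zero]; exact hnotin _ ho_fr) fun w hw => hup ⟨?_, ?_⟩
    · simpa using hw.1
    · have := hw.2; rw [mem_ball] at this ⊢; linarith
  have hp0fr : p0n ∈ frontier PD.carrier := by
    refine hfr_of p0n (by rw [hp0]; exact hnotin _ hp_fr) fun w hw => hdeep.2 ⟨hw.1, ?_⟩
    have := hw.2; rw [mem_ball] at this ⊢; linarith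
  -- ### transport and marks
  have hcar' : (PD.map φ).carrier = φ '' PD.carrier := rfl
  have hfr' : frontier (PD.map φ).carrier = φ '' frontier PD.carrier := by rw [hcar', φ.image_frontier]
  have himage : ∀ A : Set ℂ, φ '' A = (fun w => o + h * w) '' A := fun A => rfl
  have hne : D.pt 0 ≠ o := by
    intro he; rw [he, dist_self] at hdistr; linarith
  obtain ⟨Pf, hPfc, hPf0, hPf1, -⟩ := exists_dobrushinDomain_of_frontier_points (PD.map φ) (D.pt 0) o
    (by rw [hfr']; exact ⟨p0n, hp0fr, by rw [hφ_apply, hp0]⟩)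
    (by rw [hfr']; exact ⟨0, h0fr, by rw [hφ_apply, mul_zero, add_zero]⟩) hne
  rw [hcar'] at hPfc
  -- the corners
  set cornersN : Finset ℂ := ((Finset.range Per).image fun t => triEmbed ((bwalk K (0, 0) t).1 + triDir (bwalk K (0, 0) t).2)).filter
    fun c => 3 ≤ ‖c‖ ∧ 3 ≤ ‖c - p0n‖ with hcornersN
  have hIm : ∀ A B : Set ℂ, (fun w => o + h * w) '' (A ∩ B) = (fun w => o + h * w) '' A ∩ (fun w => o + h * w) '' B :=
    fun A B => (image_sim_inter_union o hh.ne' A B).1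
  have hUn : ∀ A B : Set ℂ, (fun w => o + h * w) '' (A ∪ B) = (fun w => o + h * w) '' A ∪ (fun w => o + h * w) '' B :=
    fun A B => (image_sim_inter_union o hh.ne' A B).2
  have hBall : ∀ (c : ℂ) (s : ℝ), ball (o + h * c) (h * s) = (fun w => o + h * w) '' ball c s :=
    fun c s => (image_sim_ball o hh c s).symm
  have hHp : ∀ (k : Fin 6) (c : ℂ), halfPlane k (o + h * c) = (fun w => o + h * w) '' halfPlane k c :=
    fun k c => (image_sim_halfPlane o hh k c).symm
  have hUp : ∀ c : ℂ, {z : ℂ | (o + h * c).im < z.im} = (fun w => o + h * w) '' {w : ℂ | c.im < w.im} :=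
    fun c => (image_sim_upper o hh c).symm
  have hfrI : frontier ((fun w => o + h * w) '' PD.carrier) = (fun w => o + h * w) '' frontier PD.carrier :=
    (φ.image_frontier _).symm
  have eb1 : ball o (7 * ρ / 8) = (fun w => o + h * w) '' ball 0 (7 / 8 * (ρ / h)) := by
    rw [← hBall, mul_zero, add_zero]; congr 1; field_simp
  have eu1 : {z : ℂ | o.im < z.im} = (fun w => o + h * w) '' {w : ℂ | (0 : ℂ).im < w.im} := by
    rw [← hUp, mul_zero, add_zero]
  refine ⟨Pf, cornersN.image φ, h / 16, hPf0, hPf1, ?_, ?_, ?_, ?_, ?_, by positivity, by linarith, by linarith, ?_, ?_, ?_, ?_⟩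
  · -- `P ⊆ Ω`
    rw [hPfc]; rintro _ ⟨w, hw, rfl⟩; exact hsub hw
  · -- the `η`-deep part is inside
    rw [hPfc]; intro z hz
    refine ⟨φ.symm z, hdeep.1 ?_, φ.apply_symm_apply z⟩
    show φ (φ.symm z) ∈ K'
    rw [φ.apply_symm_apply]; exact hdeepK hz
  · -- the gate half-ball
    rw [hPfc, himage, eb1, eu1, ← hIm, ← hIm, hpin1]
  · -- the root half-ball
    rw [hPfc, himage, ← hp0, show 7 * r₁ / 8 = h * (7 / 8 * (r₁ / h)) by field_simp, hBall, hUp, ← hIm, ← hIm, hpin0]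
  · -- the boundary off the pin balls is in `Ω`
    rw [hPfc, himage, hfrI]
    rintro _ ⟨⟨w, hw, rfl⟩, hnot⟩
    rcases hcyc w hw with hin' | ⟨-, hn⟩ | ⟨-, hn⟩
    · exact hin'
    · exfalso; apply hnot; left
      rw [mem_ball, dist_eq_norm, add_sub_cancel_left, norm_mul, Complex.norm_real, Real.norm_of_nonneg hh.le]
      nlinarith
    · exfalso; apply hnot; right
      rw [mem_ball, ← hp0, dist_sim o hh.le, dist_eq_norm]
      nlinarith
  · -- corners are on the boundary
    rw [hPfc, himage, hfrI, Finset.coe_image]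
    refine image_mono fun c hc => ?_
    rw [Finset.mem_coe, hcornersN, Finset.mem_filter, Finset.mem_image] at hc
    obtain ⟨⟨t, -, rfl⟩, -⟩ := hc
    exact vertex_mem_frontier hsimp hsegΓ t
  · -- corners are far from the marked points
    intro i c hc
    rw [Finset.mem_image] at hc
    obtain ⟨cN, hcN, rfl⟩ := hc
    rw [hcornersN, Finset.mem_filter] at hcN
    obtain ⟨-, h3, h3'⟩ := hcN
    fin_cases i
    · show h / 16 ≤ dist (Pf.pt 0) (φ cN)
      rw [hPf0, ← hp0, hφ_apply, dist_sim o hh.le, dist_eq_norm, ← norm_neg, neg_sub]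
      nlinarith
    · show h / 16 ≤ dist (Pf.pt 1) (φ cN)
      rw [hPf1, hφ_apply, dist_eq_norm, sub_add_cancel_left, norm_neg, norm_mul, Complex.norm_real, Real.norm_of_nonneg hh.le]
      nlinarith
  · -- flat side points
    rw [hPfc, himage, hfrI]
    rintro _ ⟨w, hw, rfl⟩ hfar
    have hfar' : ∀ t : ℕ, 3 ≤ ‖triEmbed ((bwalk K (0, 0) t).1 + triDir (bwalk K (0, 0) t).2) - 0‖ →
        3 ≤ ‖triEmbed ((bwalk K (0, 0) t).1 + triDir (bwalk K (0, 0) t).2) - p0n‖ →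
        1 / 16 ≤ dist w (triEmbed ((bwalk K (0, 0) t).1 + triDir (bwalk K (0, 0) t).2)) := by
      intro t h3 h3'
      rw [sub_zero] at h3
      have hc : φ (triEmbed ((bwalk K (0, 0) t).1 + triDir (bwalk K (0, 0) t).2)) ∈ cornersN.image φ := by
        refine Finset.mem_image_of_mem _ ?_
        rw [hcornersN, Finset.mem_filter]
        exact ⟨Finset.mem_image.2 ⟨t % Per, Finset.mem_range.2 (Nat.mod_lt t hP0), by rw [bwalk_mod_period hPd]⟩, h3, h3'⟩
      have := hfar _ hc
      rw [hφ_apply, dist_sim o hh.le] at this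
      by_contra hlt
      push Not at hlt
      nlinarith
    obtain ⟨κ, hκ⟩ := flat_side_points hsimp h₀ hPd hP0 hV hK hin hout hΓ hleft hright hsegΓ (p₁ := 0) (p₀ := p0n)
      (by linarith : (4 : ℝ) ≤ 7 / 8 * (ρ / h)) (by linarith : (4 : ℝ) ≤ 7 / 8 * (r₁ / h)) hpin1 hpin0 hw hfar'
    refine ⟨κ, ?_⟩
    rw [show h / 16 / 2 = h * (1 / 32) by ring, hBall, hHp, ← hIm, ← hIm, hκ]
  · -- corners
    intro c hc
    rw [Finset.mem_image] at hc
    obtain ⟨cN, hcN, rfl⟩ := hc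
    rw [hcornersN, Finset.mem_filter, Finset.mem_image] at hcN
    obtain ⟨⟨t, -, rfl⟩, -⟩ := hcN
    obtain ⟨k, k', hkk⟩ := corner_shape hsimp h₀ hV hK hin hout hΓ t (by norm_num : (1 : ℝ) / 8 ≤ 1 / 4)
    refine ⟨k, k', ?_⟩
    rw [hPfc, himage, hφ_apply, show 2 * (h / 16) = h * (1 / 8) by ring, hBall, hHp, hHp]
    rcases hkk with h1 | h1
    · left; rw [← hIm, ← hIm, ← hIm, h1]
    · right; rw [← hIm, ← hUn, ← hIm, h1]

end Summit.CriticalPhenomena.SAWScalingLimit.Theorems.PolygonParitySqueeze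

end
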